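import Mathlib
import HarnessLib
import Summits.HubbardSuperconductivity.HubbardSuperconductivity.Theorems.WeakCouplingBCSKlAllOrdersSelectionAnyC4
import Summits.HubbardSuperconductivity.HubbardSuperconductivity.Theorems.WeakCouplingBCSKlSelectionWindowV4
import Summits.HubbardSuperconductivity.HubbardSuperconductivity.Theorems.WeakCouplingBCSKlSelectionWindowD010D035V4

/-!
# Route `WeakCouplingBCS` — channel-margin lane of `WcbcsKohnLuttingerB1g` (stmt-HubbardSuperconductivity-0158):
# ALL ORDERS FOR EVERY REMAINDER CONSTANT on the windows of record — `μ ∈ [-0.42749, -0.1775]` (V4, `δ ∈ [0.10, 0.20]`) and the 222-row join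
# `μ ∈ [-0.8925, -0.1775]` (`δ ∈ [0.10, 0.35]`)

Instances of the generic theorems of `Theorems/WeakCouplingBCSKlAllOrdersSelectionAnyC4.lean` (`klAllOrdersC_selection_windowRows[_half]`) on the lane's two row
lists of record, `klU0WindowV4Rows` (44 rows, `u₄ = klU0WindowV4U = 1693/2²³ ≈ 2.018·10⁻⁴`; `Theorems/WeakCouplingBCSDefsKlU0WindowV4Record.lean`) and the join
`klU0WindowD010D035V4Rows` (222 rows, same `u`; `…DefsKlU0WindowD010D035V4Record.lean`), with two new KERNEL facts — the uniform second-order gaps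
`low_χ - rhohi ≥ 27969/2²⁰ ≈ 0.02667` (V4) and `≥ 10371/2²⁰ ≈ 0.00989` (join; the cert lane's margin of record) on every row and competitor (`decide +kernel`).

READING.  The all-orders theorems of record (`klAllOrders_selection_v4`, `klAllOrders_selection_d010d035v4`) say: for every remainder kernel with the rows' ASSUMED form
bound `C4 = 10`, `B1g` selection for `0 < U ≤ u`.  Here the constant is FREE: for every `μ` of the window there is a `B1g` channel state `ψ` such that for every real `C`,
every `0 < U ≤ u` with `2 (C - 10) U² u ≤ (u - U) γ₀` — in particular every `U ≤ min (u/2, ½ √(γ₀/(C - 10)))` (`_half`) — and every kernel `R` with `⟨Φ_B, R Φ_B⟩ ≤ C ‖Φ_B‖²`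
on the record trial(s) at `μ` and `⟨φ, R φ⟩ ≥ -C` on the competitor state at hand, `ψ` lies strictly below `φ` in `resummedForm ε₀ μ U · + U² ⟨·, R ·⟩`.  Numerically
(`_flat`): the threshold `u/2 = 1693/2²⁴ ≈ 1.0·10⁻⁴` serves EVERY remainder constant `C ≤ 2¹⁹ = 524288` on the V4 window and every `C ≤ 2¹⁷ = 131072` on the whole window
`δ ∈ [0.10, 0.35]` — the explicit `U₀` is insensitive to the value of the remainder constant over four to five orders of magnitude, and decays only like `½ √(γ₀/C)` beyond.
Doping-indexed forms via `muOfDoping_mem_window_d010_d020` / `…_d010_d035` (kernel-checked filling certificates, cert lanes).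

Honest framing: modulo the SAME named hypotheses as the `C4 = 10` theorems (`klCertB1gWin*.EnclosuresB1g`, second order, two interval implementations, referee-replayed;
the rows' named resummed window hypotheses, margin-1 FLOOR + chain layer, two implementations; U0-TABLE.md v4 §B–§C); the remainder bound itself stays HYPOTHETICAL — no
fourth-order non-chain diagram is bounded anywhere in the tree, and the existence of a finite `C` is the constructive programme's theorem half.  What is gained: the certificate
layer no longer depends on the assumed VALUE `10`.  Existence-grade thresholds; no new definition; nothing here asserts a pairing instability or superconductivity.
Cell file: U0-TABLE.md v4.1 (gate-hubbard-kl, margin-1 g12).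

References: S. Raghu, S. A. Kivelson, D. J. Scalapino, Phys. Rev. B 81 (2010) 224505, App. A; D. J. Scalapino, E. Loh, J. E. Hirsch,
Phys. Rev. B 34 (1986) 8190, (3)–(4).
-/

noncomputable section

-- the tree's namespace `Summit.<Summit>.<Problem>.Theorems` repeats the summit name by design (D-0017)
set_option linter.dupNamespace false

namespace Summit.HubbardSuperconductivity.HubbardSuperconductivity.Theorems

open MeasureTheory Literature.MathematicalPhysics.QuantumLattice CwKLChiralWindow KlThirdOrder
open Summit.HubbardSuperconductivity.HubbardSuperconductivity.Theses.WeakCouplingBCS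

/-! ### Kernel facts: the uniform second-order gaps of the two row lists -/

/-- Kernel decision: on every row of `klU0WindowV4Rows` and every competitor `χ`, `low_χ - rhohi ≥ 27969/2²⁰ ≈ 0.026673` (the 2⁻²⁰-rounded-down
minimum over the 44 rows, attained at row `klU0v4w33`). [folklore] -/
theorem klanyc4_v4_gap :
    (klU0WindowV4Rows.all fun w => w.row.chans.all fun c => decide (((27969 : ℚ) / 1048576) ≤ c.low - w.row.rhohi)) = true := by
  decide +kernel

/-- Kernel decision: on every row of the 222-row join `klU0WindowD010D035V4Rows` and every competitor `χ`, `low_χ - rhohi ≥ 10371/2²⁰ ≈ 0.009891`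
(the cert lane's window margin of record on `δ ∈ [0.05, 0.35]`; the row minimum is `0.0098916`, at the first `U1` row, `δ ≈ 0.35`). [folklore] -/
theorem klanyc4_d010d035v4_gap :
    (klU0WindowD010D035V4Rows.all fun w => w.row.chans.all fun c => decide (((10371 : ℚ) / 1048576) ≤ c.low - w.row.rhohi)) = true := by
  decide +kernel

/-! ### V4 window `μ ∈ [-0.42749, -0.1775] ⊃ μ([0.10, 0.20])`: every remainder constant -/

/-- **ALL ORDERS for EVERY remainder constant `C`, every `μ ∈ [-0.42749, -0.1775]`**: some `B1g` channel state `ψ` on `F_μ` such that for every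
`0 < U ≤ u₄ = klU0WindowV4U = 1693/2²³`, every real `C` with `2 (C - 10) U² u₄ ≤ (u₄ - U) · 27969/2²⁰`, and every kernel `R` (read: the non-chain part of order `≥ 4` of
`Γ_U/U⁴` at this `U`, restricted to `F_μ`) whose form is `≤ C ‖Φ_B‖²` on the `B1g` trial of the record box(es) `∋ μ` and `≥ -C` on the normalised competitor state at hand,
`ψ` lies strictly below that state in `resummedForm ε₀ μ U · + U²⟨·, R ·⟩` — modulo the NAMED hypotheses `klCertB1gWin{A,B,C}.EnclosuresB1g` and the named resummed window
hypotheses of `klU0WindowV4Rows` (U0-TABLE.md v4 §C), exactly as `klAllOrders_selection_v4` (the case `C = 10`, `U ≤ u₄`).  The remainder bound is HYPOTHETICAL; its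
existence is the constructive programme's theorem; existence-grade; nothing here asserts a pairing instability. [cite: RaghuKivelsonScalapino2010, App. A] -/
theorem klAllOrdersC_selection_v4 (hA : klCertB1gWinA.EnclosuresB1g) (hB : klCertB1gWinB.EnclosuresB1g) (hC : klCertB1gWinC.EnclosuresB1g)
    (h3 : KlResummedWindowEnclosures klU0WindowV4Rows [klCertB1gWinA, klCertB1gWinB, klCertB1gWinC]) :
    ∀ μ : ℝ, ((((-42749 : ℚ) / 100000) : ℚ) : ℝ) ≤ μ → μ ≤ ((((-71 : ℚ) / 400) : ℚ) : ℝ) →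
      ∃ ψ : Momentum → ℝ, IsChannelState (squareDispersion 1 0) μ D4Irrep.B1g ψ ∧
        ∀ U : ℝ, 0 < U → U ≤ ((klU0WindowV4U : ℚ) : ℝ) → ∀ C : ℝ,
          2 * (C - (((10 : ℚ) : ℚ) : ℝ)) * U ^ 2 * ((klU0WindowV4U : ℚ) : ℝ) ≤
              (((klU0WindowV4U : ℚ) : ℝ) - U) * ((((27969 : ℚ) / 1048576 : ℚ)) : ℝ) →
          ∀ R : Momentum → Momentum → ℝ,
            (∀ c ∈ [klCertB1gWinA, klCertB1gWinB, klCertB1gWinC], ∀ bx ∈ c.boxes, ((bx.mulo : ℚ) : ℝ) ≤ μ → μ ≤ ((bx.muhi : ℚ) : ℝ) →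
              kform (fermiCurveMeasure (squareDispersion 1 0) μ) R (bx.bB1g.trialFun c.trials) ≤
                C * ∫ k, bx.bB1g.trialFun c.trials k ^ 2 ∂fermiCurveMeasure (squareDispersion 1 0) μ) →
            ∀ χ : D4Irrep, χ ≠ D4Irrep.B1g →
              ∀ φ : Momentum → ℝ, IsChannelState (squareDispersion 1 0) μ χ φ →
                -C ≤ kform (fermiCurveMeasure (squareDispersion 1 0) μ) R φ →
                resummedForm (squareDispersion 1 0) μ U ψ + U ^ 2 * kform (fermiCurveMeasure (squareDispersion 1 0) μ) R ψ <
                  resummedForm (squareDispersion 1 0) μ U φ + U ^ 2 * kform (fermiCurveMeasure (squareDispersion 1 0) μ) R φ :=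
  klAllOrdersC_selection_windowRows klU0WindowV4Rows _ _ _ _ _ _ _ klU0WindowV4Rows_check klsel_v4_join (klto_window_recs hA hB hC) h3
    klsel_v4_consts (by norm_num) klanyc4_v4_gap

/-- **The explicit threshold `U₀(C) = min (u₄/2, ½ √(0.026673/(C - 10)))` on the V4 window**: as `klAllOrdersC_selection_v4`, for every `0 < U` with `2U ≤ u₄` and
`4 (C - 10) U² ≤ 27969/2²⁰`. [cite: RaghuKivelsonScalapino2010, App. A] -/
theorem klAllOrdersC_selection_v4_half (hA : klCertB1gWinA.EnclosuresB1g) (hB : klCertB1gWinB.EnclosuresB1g) (hC : klCertB1gWinC.EnclosuresB1g)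
    (h3 : KlResummedWindowEnclosures klU0WindowV4Rows [klCertB1gWinA, klCertB1gWinB, klCertB1gWinC]) :
    ∀ μ : ℝ, ((((-42749 : ℚ) / 100000) : ℚ) : ℝ) ≤ μ → μ ≤ ((((-71 : ℚ) / 400) : ℚ) : ℝ) →
      ∃ ψ : Momentum → ℝ, IsChannelState (squareDispersion 1 0) μ D4Irrep.B1g ψ ∧
        ∀ U : ℝ, 0 < U → 2 * U ≤ ((klU0WindowV4U : ℚ) : ℝ) → ∀ C : ℝ,
          4 * (C - (((10 : ℚ) : ℚ) : ℝ)) * U ^ 2 ≤ ((((27969 : ℚ) / 1048576 : ℚ)) : ℝ) →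
          ∀ R : Momentum → Momentum → ℝ,
            (∀ c ∈ [klCertB1gWinA, klCertB1gWinB, klCertB1gWinC], ∀ bx ∈ c.boxes, ((bx.mulo : ℚ) : ℝ) ≤ μ → μ ≤ ((bx.muhi : ℚ) : ℝ) →
              kform (fermiCurveMeasure (squareDispersion 1 0) μ) R (bx.bB1g.trialFun c.trials) ≤
                C * ∫ k, bx.bB1g.trialFun c.trials k ^ 2 ∂fermiCurveMeasure (squareDispersion 1 0) μ) →
            ∀ χ : D4Irrep, χ ≠ D4Irrep.B1g →
              ∀ φ : Momentum → ℝ, IsChannelState (squareDispersion 1 0) μ χ φ →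
                -C ≤ kform (fermiCurveMeasure (squareDispersion 1 0) μ) R φ →
                resummedForm (squareDispersion 1 0) μ U ψ + U ^ 2 * kform (fermiCurveMeasure (squareDispersion 1 0) μ) R ψ <
                  resummedForm (squareDispersion 1 0) μ U φ + U ^ 2 * kform (fermiCurveMeasure (squareDispersion 1 0) μ) R φ :=
  klAllOrdersC_selection_windowRows_half klU0WindowV4Rows _ _ _ _ _ _ _ klU0WindowV4Rows_check klsel_v4_join (klto_window_recs hA hB hC) h3
    klsel_v4_consts (by norm_num) klanyc4_v4_gap

/-- **Flat threshold for every remainder constant up to `2¹⁹`** on the V4 window: for every real `C ≤ 524288` (in particular the rows' assumed `10`, or `10³`, `10⁵`) and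
every `0 < U ≤ u₄/2 = 1693/2²⁴ ≈ 1.009·10⁻⁴`, `B1g` selection to all orders in the sense of `klAllOrdersC_selection_v4` — the threshold is INSENSITIVE to the remainder
constant over five orders of magnitude (`4 (2¹⁹ - 10) (u₄/2)² ≈ 0.02136 ≤ 0.02667`). [cite: RaghuKivelsonScalapino2010, App. A] -/
theorem klAllOrdersC_selection_v4_flat (hA : klCertB1gWinA.EnclosuresB1g) (hB : klCertB1gWinB.EnclosuresB1g) (hC : klCertB1gWinC.EnclosuresB1g)
    (h3 : KlResummedWindowEnclosures klU0WindowV4Rows [klCertB1gWinA, klCertB1gWinB, klCertB1gWinC]) :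
    ∀ μ : ℝ, ((((-42749 : ℚ) / 100000) : ℚ) : ℝ) ≤ μ → μ ≤ ((((-71 : ℚ) / 400) : ℚ) : ℝ) →
      ∃ ψ : Momentum → ℝ, IsChannelState (squareDispersion 1 0) μ D4Irrep.B1g ψ ∧
        ∀ U : ℝ, 0 < U → 2 * U ≤ ((klU0WindowV4U : ℚ) : ℝ) → ∀ C : ℝ, C ≤ 524288 →
          ∀ R : Momentum → Momentum → ℝ,
            (∀ c ∈ [klCertB1gWinA, klCertB1gWinB, klCertB1gWinC], ∀ bx ∈ c.boxes, ((bx.mulo : ℚ) : ℝ) ≤ μ → μ ≤ ((bx.muhi : ℚ) : ℝ) →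
              kform (fermiCurveMeasure (squareDispersion 1 0) μ) R (bx.bB1g.trialFun c.trials) ≤
                C * ∫ k, bx.bB1g.trialFun c.trials k ^ 2 ∂fermiCurveMeasure (squareDispersion 1 0) μ) →
            ∀ χ : D4Irrep, χ ≠ D4Irrep.B1g →
              ∀ φ : Momentum → ℝ, IsChannelState (squareDispersion 1 0) μ χ φ →
                -C ≤ kform (fermiCurveMeasure (squareDispersion 1 0) μ) R φ →
                resummedForm (squareDispersion 1 0) μ U ψ + U ^ 2 * kform (fermiCurveMeasure (squareDispersion 1 0) μ) R ψ <
                  resummedForm (squareDispersion 1 0) μ U φ + U ^ 2 * kform (fermiCurveMeasure (squareDispersion 1 0) μ) R φ := by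
  intro μ hμ₁ hμ₂
  obtain ⟨ψ, hψ, hsel⟩ := klAllOrdersC_selection_v4_half hA hB hC h3 μ hμ₁ hμ₂
  refine ⟨ψ, hψ, fun U hU h2U C hCle R hRB χ hχ φ hφ hRχ => hsel U hU h2U C ?_ R hRB χ hχ φ hφ hRχ⟩
  have hu : ((klU0WindowV4U : ℚ) : ℝ) = 1693 / 8388608 := by
    show ((((1693 : ℚ) / 8388608) : ℚ) : ℝ) = 1693 / 8388608
    push_cast; ring
  rw [hu] at h2U
  have hU2 : U ^ 2 ≤ (1693 / 16777216 : ℝ) ^ 2 := by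
    have hUle : U ≤ 1693 / 16777216 := by linarith
    exact pow_le_pow_left₀ hU.le hUle 2
  have h1 : 4 * (C - (((10 : ℚ) : ℚ) : ℝ)) * U ^ 2 ≤ 4 * (524288 - 10) * U ^ 2 := by
    have : (C - (((10 : ℚ) : ℚ) : ℝ)) ≤ 524288 - 10 := by push_cast; linarith
    have hU2nn : 0 ≤ U ^ 2 := sq_nonneg U
    nlinarith
  have h2 : 4 * (524288 - 10 : ℝ) * U ^ 2 ≤ 4 * (524288 - 10) * (1693 / 16777216 : ℝ) ^ 2 :=
    mul_le_mul_of_nonneg_left hU2 (by norm_num)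
  have h3' : 4 * (524288 - 10) * (1693 / 16777216 : ℝ) ^ 2 ≤ ((((27969 : ℚ) / 1048576 : ℚ)) : ℝ) := by
    push_cast; norm_num
  exact h1.trans (h2.trans h3')

/-- **Indexed by the doping `δ ∈ [0.10, 0.20]`** (`muOfDoping_mem_window_d010_d020`): at `μ(δ)`, `B1g` selection to all orders for every remainder constant `C`, every
`0 < U` with `2U ≤ u₄` and `4 (C - 10) U² ≤ 27969/2²⁰`, in the sense of `klAllOrdersC_selection_v4`. [cite: RaghuKivelsonScalapino2010, App. A] -/
theorem klAllOrdersC_selection_v4_doping (hA : klCertB1gWinA.EnclosuresB1g) (hB : klCertB1gWinB.EnclosuresB1g) (hC : klCertB1gWinC.EnclosuresB1g)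
    (h3 : KlResummedWindowEnclosures klU0WindowV4Rows [klCertB1gWinA, klCertB1gWinB, klCertB1gWinC])
    (δ : ℝ) (hδ : δ ∈ Set.Icc (0.10 : ℝ) 0.20) :
    ∃ ψ : Momentum → ℝ, IsChannelState (squareDispersion 1 0) (chemicalPotentialOfDensity (squareDispersion 1 0) (1 - δ)) D4Irrep.B1g ψ ∧
      ∀ U : ℝ, 0 < U → 2 * U ≤ ((klU0WindowV4U : ℚ) : ℝ) → ∀ C : ℝ,
        4 * (C - (((10 : ℚ) : ℚ) : ℝ)) * U ^ 2 ≤ ((((27969 : ℚ) / 1048576 : ℚ)) : ℝ) →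
        ∀ R : Momentum → Momentum → ℝ,
          (∀ c ∈ [klCertB1gWinA, klCertB1gWinB, klCertB1gWinC], ∀ bx ∈ c.boxes,
            ((bx.mulo : ℚ) : ℝ) ≤ chemicalPotentialOfDensity (squareDispersion 1 0) (1 - δ) →
            chemicalPotentialOfDensity (squareDispersion 1 0) (1 - δ) ≤ ((bx.muhi : ℚ) : ℝ) →
              kform (fermiCurveMeasure (squareDispersion 1 0) (chemicalPotentialOfDensity (squareDispersion 1 0) (1 - δ))) R
                  (bx.bB1g.trialFun c.trials) ≤
                C * ∫ k, bx.bB1g.trialFun c.trials k ^ 2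
                  ∂fermiCurveMeasure (squareDispersion 1 0) (chemicalPotentialOfDensity (squareDispersion 1 0) (1 - δ))) →
          ∀ χ : D4Irrep, χ ≠ D4Irrep.B1g →
            ∀ φ : Momentum → ℝ, IsChannelState (squareDispersion 1 0) (chemicalPotentialOfDensity (squareDispersion 1 0) (1 - δ)) χ φ →
              -C ≤ kform (fermiCurveMeasure (squareDispersion 1 0) (chemicalPotentialOfDensity (squareDispersion 1 0) (1 - δ))) R φ →
              resummedForm (squareDispersion 1 0) (chemicalPotentialOfDensity (squareDispersion 1 0) (1 - δ)) U ψ +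
                  U ^ 2 * kform (fermiCurveMeasure (squareDispersion 1 0) (chemicalPotentialOfDensity (squareDispersion 1 0) (1 - δ))) R ψ <
                resummedForm (squareDispersion 1 0) (chemicalPotentialOfDensity (squareDispersion 1 0) (1 - δ)) U φ +
                  U ^ 2 * kform (fermiCurveMeasure (squareDispersion 1 0) (chemicalPotentialOfDensity (squareDispersion 1 0) (1 - δ))) R φ := by
  obtain ⟨h₁, h₂⟩ := muOfDoping_mem_window_d010_d020 δ hδ
  exact klAllOrdersC_selection_v4_half hA hB hC h3 _ (by push_cast; linarith) (by push_cast; linarith)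

/-! ### The 222-row join `μ ∈ [-0.8925, -0.1775] = μ([0.10, 0.35])`: every remainder constant -/

/-- **ALL ORDERS for EVERY remainder constant `C`, every `μ ∈ [-0.8925, -0.1775]`** (the lane's whole window of record, `δ ∈ [0.10, 0.35]`): as
`klAllOrdersC_selection_v4`, on the join `klU0WindowD010D035V4Rows` with `u = klU0WindowD010D035V4U = 1693/2²³` and uniform gap `10371/2²⁰ ≈ 0.009891`: for every `0 < U ≤ u`, every real `C`
with `2 (C - 10) U² u ≤ (u - U) · 10371/2²⁰`, every admissible `R` — modulo `klCertB1gWin{U1,U3,U2,W,V,Y,X,Z,A,B,C}.EnclosuresB1g` and the rows' named resummed window hypotheses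
(U0-TABLE.md v4 §B–§C), exactly as `klAllOrders_selection_d010d035v4` (the case `C = 10`).  Remainder bound HYPOTHETICAL; existence-grade; nothing here asserts a pairing
instability. [cite: RaghuKivelsonScalapino2010, App. A] -/
theorem klAllOrdersC_selection_d010d035v4 (hU1 : klCertB1gWinU1.EnclosuresB1g) (hU3 : klCertB1gWinU3.EnclosuresB1g) (hU2 : klCertB1gWinU2.EnclosuresB1g)
    (hW : klCertB1gWinW.EnclosuresB1g) (hV : klCertB1gWinV.EnclosuresB1g) (hY : klCertB1gWinY.EnclosuresB1g) (hX : klCertB1gWinX.EnclosuresB1g)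
    (hZ : klCertB1gWinZ.EnclosuresB1g) (hA : klCertB1gWinA.EnclosuresB1g) (hB : klCertB1gWinB.EnclosuresB1g) (hC : klCertB1gWinC.EnclosuresB1g)
    (h3 : KlResummedWindowEnclosures klU0WindowD010D035V4Rows [klCertB1gWinU1, klCertB1gWinU3, klCertB1gWinU2, klCertB1gWinW, klCertB1gWinV,
      klCertB1gWinY, klCertB1gWinX, klCertB1gWinZ, klCertB1gWinA, klCertB1gWinB, klCertB1gWinC]) :
    ∀ μ : ℝ, ((((-357 : ℚ) / 400) : ℚ) : ℝ) ≤ μ → μ ≤ ((((-71 : ℚ) / 400) : ℚ) : ℝ) →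
      ∃ ψ : Momentum → ℝ, IsChannelState (squareDispersion 1 0) μ D4Irrep.B1g ψ ∧
        ∀ U : ℝ, 0 < U → U ≤ ((klU0WindowD010D035V4U : ℚ) : ℝ) → ∀ C : ℝ,
          2 * (C - (((10 : ℚ) : ℚ) : ℝ)) * U ^ 2 * ((klU0WindowD010D035V4U : ℚ) : ℝ) ≤
              (((klU0WindowD010D035V4U : ℚ) : ℝ) - U) * ((((10371 : ℚ) / 1048576 : ℚ)) : ℝ) →
          ∀ R : Momentum → Momentum → ℝ,
            (∀ c ∈ [klCertB1gWinU1, klCertB1gWinU3, klCertB1gWinU2, klCertB1gWinW, klCertB1gWinV, klCertB1gWinY, klCertB1gWinX, klCertB1gWinZ,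
                klCertB1gWinA, klCertB1gWinB, klCertB1gWinC], ∀ bx ∈ c.boxes, ((bx.mulo : ℚ) : ℝ) ≤ μ → μ ≤ ((bx.muhi : ℚ) : ℝ) →
              kform (fermiCurveMeasure (squareDispersion 1 0) μ) R (bx.bB1g.trialFun c.trials) ≤
                C * ∫ k, bx.bB1g.trialFun c.trials k ^ 2 ∂fermiCurveMeasure (squareDispersion 1 0) μ) →
            ∀ χ : D4Irrep, χ ≠ D4Irrep.B1g →
              ∀ φ : Momentum → ℝ, IsChannelState (squareDispersion 1 0) μ χ φ →
                -C ≤ kform (fermiCurveMeasure (squareDispersion 1 0) μ) R φ →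
                resummedForm (squareDispersion 1 0) μ U ψ + U ^ 2 * kform (fermiCurveMeasure (squareDispersion 1 0) μ) R ψ <
                  resummedForm (squareDispersion 1 0) μ U φ + U ^ 2 * kform (fermiCurveMeasure (squareDispersion 1 0) μ) R φ :=
  klAllOrdersC_selection_windowRows klU0WindowD010D035V4Rows _ _ _ _ _ _ _ klU0WindowD010D035V4Rows_check klsel_d010d035v4_join
    (klsel_d010d035_recs hU1 hU3 hU2 hW hV hY hX hZ hA hB hC) h3 klsel_d010d035v4_consts (by norm_num) klanyc4_d010d035v4_gap

/-- **The explicit threshold `U₀(C) = min (u/2, ½ √(0.00989/(C - 10)))` on the whole window `δ ∈ [0.10, 0.35]`**: as `klAllOrdersC_selection_d010d035v4`, for every `0 < U` with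
`2U ≤ u` and `4 (C - 10) U² ≤ 10371/2²⁰`. [cite: RaghuKivelsonScalapino2010, App. A] -/
theorem klAllOrdersC_selection_d010d035v4_half (hU1 : klCertB1gWinU1.EnclosuresB1g) (hU3 : klCertB1gWinU3.EnclosuresB1g) (hU2 : klCertB1gWinU2.EnclosuresB1g)
    (hW : klCertB1gWinW.EnclosuresB1g) (hV : klCertB1gWinV.EnclosuresB1g) (hY : klCertB1gWinY.EnclosuresB1g) (hX : klCertB1gWinX.EnclosuresB1g)
    (hZ : klCertB1gWinZ.EnclosuresB1g) (hA : klCertB1gWinA.EnclosuresB1g) (hB : klCertB1gWinB.EnclosuresB1g) (hC : klCertB1gWinC.EnclosuresB1g)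
    (h3 : KlResummedWindowEnclosures klU0WindowD010D035V4Rows [klCertB1gWinU1, klCertB1gWinU3, klCertB1gWinU2, klCertB1gWinW, klCertB1gWinV,
      klCertB1gWinY, klCertB1gWinX, klCertB1gWinZ, klCertB1gWinA, klCertB1gWinB, klCertB1gWinC]) :
    ∀ μ : ℝ, ((((-357 : ℚ) / 400) : ℚ) : ℝ) ≤ μ → μ ≤ ((((-71 : ℚ) / 400) : ℚ) : ℝ) →
      ∃ ψ : Momentum → ℝ, IsChannelState (squareDispersion 1 0) μ D4Irrep.B1g ψ ∧
        ∀ U : ℝ, 0 < U → 2 * U ≤ ((klU0WindowD010D035V4U : ℚ) : ℝ) → ∀ C : ℝ,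
          4 * (C - (((10 : ℚ) : ℚ) : ℝ)) * U ^ 2 ≤ ((((10371 : ℚ) / 1048576 : ℚ)) : ℝ) →
          ∀ R : Momentum → Momentum → ℝ,
            (∀ c ∈ [klCertB1gWinU1, klCertB1gWinU3, klCertB1gWinU2, klCertB1gWinW, klCertB1gWinV, klCertB1gWinY, klCertB1gWinX, klCertB1gWinZ,
                klCertB1gWinA, klCertB1gWinB, klCertB1gWinC], ∀ bx ∈ c.boxes, ((bx.mulo : ℚ) : ℝ) ≤ μ → μ ≤ ((bx.muhi : ℚ) : ℝ) →
              kform (fermiCurveMeasure (squareDispersion 1 0) μ) R (bx.bB1g.trialFun c.trials) ≤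
                C * ∫ k, bx.bB1g.trialFun c.trials k ^ 2 ∂fermiCurveMeasure (squareDispersion 1 0) μ) →
            ∀ χ : D4Irrep, χ ≠ D4Irrep.B1g →
              ∀ φ : Momentum → ℝ, IsChannelState (squareDispersion 1 0) μ χ φ →
                -C ≤ kform (fermiCurveMeasure (squareDispersion 1 0) μ) R φ →
                resummedForm (squareDispersion 1 0) μ U ψ + U ^ 2 * kform (fermiCurveMeasure (squareDispersion 1 0) μ) R ψ <
                  resummedForm (squareDispersion 1 0) μ U φ + U ^ 2 * kform (fermiCurveMeasure (squareDispersion 1 0) μ) R φ :=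
  klAllOrdersC_selection_windowRows_half klU0WindowD010D035V4Rows _ _ _ _ _ _ _ klU0WindowD010D035V4Rows_check klsel_d010d035v4_join
    (klsel_d010d035_recs hU1 hU3 hU2 hW hV hY hX hZ hA hB hC) h3 klsel_d010d035v4_consts (by norm_num) klanyc4_d010d035v4_gap

/-- **Flat threshold for every remainder constant up to `2¹⁷` on the whole window `δ ∈ [0.10, 0.35]`**: for every real `C ≤ 131072` and every `0 < U ≤ u/2 = 1693/2²⁴ ≈ 1.009·10⁻⁴`,
`B1g` selection to all orders in the sense of `klAllOrdersC_selection_d010d035v4` (`4 (2¹⁷ - 10)(u/2)² ≈ 0.00534 ≤ 0.00989`). [cite: RaghuKivelsonScalapino2010, App. A] -/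
theorem klAllOrdersC_selection_d010d035v4_flat (hU1 : klCertB1gWinU1.EnclosuresB1g) (hU3 : klCertB1gWinU3.EnclosuresB1g) (hU2 : klCertB1gWinU2.EnclosuresB1g)
    (hW : klCertB1gWinW.EnclosuresB1g) (hV : klCertB1gWinV.EnclosuresB1g) (hY : klCertB1gWinY.EnclosuresB1g) (hX : klCertB1gWinX.EnclosuresB1g)
    (hZ : klCertB1gWinZ.EnclosuresB1g) (hA : klCertB1gWinA.EnclosuresB1g) (hB : klCertB1gWinB.EnclosuresB1g) (hC : klCertB1gWinC.EnclosuresB1g)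
    (h3 : KlResummedWindowEnclosures klU0WindowD010D035V4Rows [klCertB1gWinU1, klCertB1gWinU3, klCertB1gWinU2, klCertB1gWinW, klCertB1gWinV,
      klCertB1gWinY, klCertB1gWinX, klCertB1gWinZ, klCertB1gWinA, klCertB1gWinB, klCertB1gWinC]) :
    ∀ μ : ℝ, ((((-357 : ℚ) / 400) : ℚ) : ℝ) ≤ μ → μ ≤ ((((-71 : ℚ) / 400) : ℚ) : ℝ) →
      ∃ ψ : Momentum → ℝ, IsChannelState (squareDispersion 1 0) μ D4Irrep.B1g ψ ∧
        ∀ U : ℝ, 0 < U → 2 * U ≤ ((klU0WindowD010D035V4U : ℚ) : ℝ) → ∀ C : ℝ, C ≤ 131072 →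
          ∀ R : Momentum → Momentum → ℝ,
            (∀ c ∈ [klCertB1gWinU1, klCertB1gWinU3, klCertB1gWinU2, klCertB1gWinW, klCertB1gWinV, klCertB1gWinY, klCertB1gWinX, klCertB1gWinZ,
                klCertB1gWinA, klCertB1gWinB, klCertB1gWinC], ∀ bx ∈ c.boxes, ((bx.mulo : ℚ) : ℝ) ≤ μ → μ ≤ ((bx.muhi : ℚ) : ℝ) →
              kform (fermiCurveMeasure (squareDispersion 1 0) μ) R (bx.bB1g.trialFun c.trials) ≤
                C * ∫ k, bx.bB1g.trialFun c.trials k ^ 2 ∂fermiCurveMeasure (squareDispersion 1 0) μ) →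
            ∀ χ : D4Irrep, χ ≠ D4Irrep.B1g →
              ∀ φ : Momentum → ℝ, IsChannelState (squareDispersion 1 0) μ χ φ →
                -C ≤ kform (fermiCurveMeasure (squareDispersion 1 0) μ) R φ →
                resummedForm (squareDispersion 1 0) μ U ψ + U ^ 2 * kform (fermiCurveMeasure (squareDispersion 1 0) μ) R ψ <
                  resummedForm (squareDispersion 1 0) μ U φ + U ^ 2 * kform (fermiCurveMeasure (squareDispersion 1 0) μ) R φ := by
  intro μ hμ₁ hμ₂
  obtain ⟨ψ, hψ, hsel⟩ := klAllOrdersC_selection_d010d035v4_half hU1 hU3 hU2 hW hV hY hX hZ hA hB hC h3 μ hμ₁ hμ₂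
  refine ⟨ψ, hψ, fun U hU h2U C hCle R hRB χ hχ φ hφ hRχ => hsel U hU h2U C ?_ R hRB χ hχ φ hφ hRχ⟩
  have hu : ((klU0WindowD010D035V4U : ℚ) : ℝ) = 1693 / 8388608 := by
    show ((((1693 : ℚ) / 8388608) : ℚ) : ℝ) = 1693 / 8388608
    push_cast; ring
  rw [hu] at h2U
  have hU2 : U ^ 2 ≤ (1693 / 16777216 : ℝ) ^ 2 := by
    have hUle : U ≤ 1693 / 16777216 := by linarith
    exact pow_le_pow_left₀ hU.le hUle 2
  have h1 : 4 * (C - (((10 : ℚ) : ℚ) : ℝ)) * U ^ 2 ≤ 4 * (131072 - 10) * U ^ 2 := by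
    have : (C - (((10 : ℚ) : ℚ) : ℝ)) ≤ 131072 - 10 := by push_cast; linarith
    have hU2nn : 0 ≤ U ^ 2 := sq_nonneg U
    nlinarith
  have h2 : 4 * (131072 - 10 : ℝ) * U ^ 2 ≤ 4 * (131072 - 10) * (1693 / 16777216 : ℝ) ^ 2 :=
    mul_le_mul_of_nonneg_left hU2 (by norm_num)
  have h3' : 4 * (131072 - 10) * (1693 / 16777216 : ℝ) ^ 2 ≤ ((((10371 : ℚ) / 1048576 : ℚ)) : ℝ) := by
    push_cast; norm_num
  exact h1.trans (h2.trans h3')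

/-- **Indexed by the doping `δ ∈ [0.10, 0.35]`** (`muOfDoping_mem_window_d010_d035`): at `μ(δ)`, `B1g` selection to all orders for every remainder constant `C`, every
`0 < U` with `2U ≤ u` and `4 (C - 10) U² ≤ 10371/2²⁰`, in the sense of `klAllOrdersC_selection_d010d035v4`. [cite: RaghuKivelsonScalapino2010, App. A] -/
theorem klAllOrdersC_selection_d010d035v4_doping (hU1 : klCertB1gWinU1.EnclosuresB1g) (hU3 : klCertB1gWinU3.EnclosuresB1g) (hU2 : klCertB1gWinU2.EnclosuresB1g)
    (hW : klCertB1gWinW.EnclosuresB1g) (hV : klCertB1gWinV.EnclosuresB1g) (hY : klCertB1gWinY.EnclosuresB1g) (hX : klCertB1gWinX.EnclosuresB1g)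
    (hZ : klCertB1gWinZ.EnclosuresB1g) (hA : klCertB1gWinA.EnclosuresB1g) (hB : klCertB1gWinB.EnclosuresB1g) (hC : klCertB1gWinC.EnclosuresB1g)
    (h3 : KlResummedWindowEnclosures klU0WindowD010D035V4Rows [klCertB1gWinU1, klCertB1gWinU3, klCertB1gWinU2, klCertB1gWinW, klCertB1gWinV,
      klCertB1gWinY, klCertB1gWinX, klCertB1gWinZ, klCertB1gWinA, klCertB1gWinB, klCertB1gWinC])
    (δ : ℝ) (hδ : δ ∈ Set.Icc (0.10 : ℝ) 0.35) :
    ∃ ψ : Momentum → ℝ, IsChannelState (squareDispersion 1 0) (chemicalPotentialOfDensity (squareDispersion 1 0) (1 - δ)) D4Irrep.B1g ψ ∧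
      ∀ U : ℝ, 0 < U → 2 * U ≤ ((klU0WindowD010D035V4U : ℚ) : ℝ) → ∀ C : ℝ,
        4 * (C - (((10 : ℚ) : ℚ) : ℝ)) * U ^ 2 ≤ ((((10371 : ℚ) / 1048576 : ℚ)) : ℝ) →
        ∀ R : Momentum → Momentum → ℝ,
          (∀ c ∈ [klCertB1gWinU1, klCertB1gWinU3, klCertB1gWinU2, klCertB1gWinW, klCertB1gWinV, klCertB1gWinY, klCertB1gWinX, klCertB1gWinZ,
              klCertB1gWinA, klCertB1gWinB, klCertB1gWinC], ∀ bx ∈ c.boxes,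
            ((bx.mulo : ℚ) : ℝ) ≤ chemicalPotentialOfDensity (squareDispersion 1 0) (1 - δ) →
            chemicalPotentialOfDensity (squareDispersion 1 0) (1 - δ) ≤ ((bx.muhi : ℚ) : ℝ) →
              kform (fermiCurveMeasure (squareDispersion 1 0) (chemicalPotentialOfDensity (squareDispersion 1 0) (1 - δ))) R
                  (bx.bB1g.trialFun c.trials) ≤
                C * ∫ k, bx.bB1g.trialFun c.trials k ^ 2
                  ∂fermiCurveMeasure (squareDispersion 1 0) (chemicalPotentialOfDensity (squareDispersion 1 0) (1 - δ))) →
          ∀ χ : D4Irrep, χ ≠ D4Irrep.B1g →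
            ∀ φ : Momentum → ℝ, IsChannelState (squareDispersion 1 0) (chemicalPotentialOfDensity (squareDispersion 1 0) (1 - δ)) χ φ →
              -C ≤ kform (fermiCurveMeasure (squareDispersion 1 0) (chemicalPotentialOfDensity (squareDispersion 1 0) (1 - δ))) R φ →
              resummedForm (squareDispersion 1 0) (chemicalPotentialOfDensity (squareDispersion 1 0) (1 - δ)) U ψ +
                  U ^ 2 * kform (fermiCurveMeasure (squareDispersion 1 0) (chemicalPotentialOfDensity (squareDispersion 1 0) (1 - δ))) R ψ <
                resummedForm (squareDispersion 1 0) (chemicalPotentialOfDensity (squareDispersion 1 0) (1 - δ)) U φ +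
                  U ^ 2 * kform (fermiCurveMeasure (squareDispersion 1 0) (chemicalPotentialOfDensity (squareDispersion 1 0) (1 - δ))) R φ := by
  obtain ⟨h₁, h₂⟩ := muOfDoping_mem_window_d010_d035 δ hδ
  exact klAllOrdersC_selection_d010d035v4_half hU1 hU3 hU2 hW hV hY hX hZ hA hB hC h3 _ (by push_cast; linarith) (by push_cast; linarith)

end Summit.HubbardSuperconductivity.HubbardSuperconductivity.Theorems

end
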